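import Mathlib.NumberTheory.Padics.ProperSpace
import Mathlib.NumberTheory.Padics.RingHoms
import Mathlib.Topology.Algebra.OpenSubgroup
import Mathlib.Topology.MetricSpace.Ultra.Basic
import Mathlib.LinearAlgebra.Dimension.Basic
import Mathlib.LinearAlgebra.Pi
import HarnessLib

/-!
# Input (Λ3)-compact of the `Λ`-adic road to SURJ⁺@2 (item 23110 at every rank), PURE ALGEBRA:
# a `ℤ_p`-submodule of a torsion-free, `p`-adically SEPARATED (not necessarily finitely generated) `ℤ_p`-module whose
# reductions modulo `p^k` have at most `C · p^{Bk}` values has `ℤ_p`-rank `≤ B`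

Routes `ResidualThetaTransportAtTwo` (RTT, crux r201 `ResidualLambdaFormulaNegDiscAtTwo`, stmt-BirchSwinnertonDyer-23110) /
`ThetaPartnerAtTwo` (K1 `stub_surj2`; K3 aside). Seat `prover-bsd-wall-tp2-p2x-w3` g12 (width of the K3 lead tp2-p2x g12, who holds
23110); `--supports stmt-BirchSwinnertonDyer-23110`. THEOREMS ONLY (no definition, no named fact, no `sorry`); closes nothing.

WHY (memo ALL-RANK-RLF-ROADS-w4g0 §4, seat rtt-w4; file `…UniversalNormTowerVanishing`, seat tp2-p2x-w2 g14). The tower-vanishing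
engine `TowerVanishing.forall_eq_zero_of_layerCores_eq_of_mem_of_rank_le[_of_goodSS]` kills every norm-compatible family of
classes of `T_pE` living in `conj_γ`-stable `ℤ_p`-submodules `S n ⊆ H¹(ℚ_n, T_pE)` of UNIFORMLY BOUNDED `ℤ_p`-RANK. The intended
`S n` are the compact signed Selmer layers `𝔖⁺(E/ℚ_n) = {x ∈ H¹(ℚ_n, T₂E) | x mod 2^k ∈ Sel⁺(ℚ_n, E[2^k]) ∀ k}`, and what the
tree bounds (`TowerVanishing.zpCorank_signedSelmerLayer_le_lambda`, p645699) is the `ℤ₂`-CORANK of the DISCRETE `Sel⁺(E/ℚ_n)`.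
The passage «rank of the compact group ≤ corank of the discrete group» is the glue this file and its sequel
(`…CompactLayerRankBound`) supply. The ambient `H¹(ℚ_n, T_pE)` (full Galois group) is NOT a finitely generated `ℤ_p`-module, so
the usual lattice argument (saturate a free submodule inside a finitely generated module) is unavailable; it is replaced by the
COMPACTNESS of `ℤ_p^{B+1}` and the two properties of `H¹(ℚ_n, T_pE)` that the tree does prove at every layer: it is
TORSION-FREE (`TowerVanishing.layerH1_eq_zero_of_pow_smul_eq_zero_of_goodSS`, p645404) and `p`-adically SEPARATED
(`Kato2004.eq_zero_of_forall_mem_pow_smul`, Rubin App. B Prop. B.2.3).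

THE LEMMA (`rank_le_of_card_image_le`). Let `H` be a `ℤ_p`-module with `p • x = 0 → x = 0` and `⋂_k p^k H = 0`, `S ⊆ H` a
submodule, and for every `k` an additive map `f_k : S → G_k` with values in a finite set `T_k`, `#T_k ≤ C · p^{Bk}`, whose kernel
consists of `p^k`-multiples IN `H`. Then `rank_{ℤ_p} S ≤ B`. PROOF. If not, `Module.le_rank_iff_exists_linearMap` gives an
injective `φ : ℤ_p^{B+1} → S ⊆ H`. For `M : ℕ` let `E_M = φ⁻¹(p^M H)` — a submodule containing the open subgroup `p^M ℤ_p^{B+1}`,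
hence open and closed — and `P = ℤ_p^{B+1} ∖ p ℤ_p^{B+1}` (closed). The closed sets `P ∩ E_M` of the compact `ℤ_p^{B+1}` decrease
and have empty intersection (`⋂_M E_M = φ⁻¹(⋂ p^M H) = φ⁻¹(0) = 0 ∌` primitive vectors), so ONE of them is empty (Cantor,
`IsCompact.nonempty_iInter_of_directed_nonempty_isCompact_isClosed`): there is `M` with `φ v ∈ p^M H ⇒ v ∈ p ℤ_p^{B+1}`.
Cancelling `p` in the torsion-free `H` and iterating, `φ v ∈ p^k H ⇒ v ∈ p^{k+1−M} ℤ_p^{B+1}`. Hence for `k = M + N`,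
`m = N + 1`, the map `(ℤ/p^m)^{B+1} → T_k`, `a ↦ f_k(φ a)`, is injective (`PadicInt.ker_toZModPow`), so
`p^{m(B+1)} ≤ C · p^{B(M+N)}`, i.e. `p^{N+1} ≤ C · p^{BM} = N` for the choice `N = C · p^{BM}` — contradicting `N < p^N`.

* `isOpen_span_pow`, `isOpen_pi_span_pow` — `p^M ℤ_p` and `p^M ℤ_p^ι` are open;
* `smul_cancel_of_torsionFree` — `p^j • a = p^j • b → a = b` from `p • x = 0 → x = 0`;
* `rank_le_of_card_image_le` — the lemma.

HONEST FRAMING: closes nothing; 23110 is NOT proved; BSD is not proved by any of this.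
References: [GreenbergVatsal2000] §2 Prop. (2.1); [GreenbergLNM1716] §1 p. 60 (cofinitely generated modules, corank);
[Rubin2000] App. B Prop. B.2.3 (`H¹(K,T) = lim← H¹(K,T/p^n)`); [Kato2004Asterisque] §8.2 (p. 180), §13.8 (p. 228); [folklore] algebra.
-/

set_option autoImplicit false
-- D-0017: single-problem summit, so `Summit.BirchSwinnertonDyer.BirchSwinnertonDyer.…` repeats a namespace BY DESIGN.
set_option linter.dupNamespace false

noncomputable section

open scoped Classical

namespace Summit.BirchSwinnertonDyer.BirchSwinnertonDyer.Theorems.ResidualThetaLayer.CompactRank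

variable {p : ℕ} [hp : Fact p.Prime]

/-- **`p^M ℤ_p` is open in `ℤ_p`**: it is the closed ball of radius `p^{−M}` (`PadicInt.norm_le_pow_iff_mem_span_pow`), open in
the ultrametric `ℤ_p`. [folklore] -/
theorem isOpen_span_pow (M : ℕ) : IsOpen ((Ideal.span {(p : ℤ_[p]) ^ M} : Ideal ℤ_[p]) : Set ℤ_[p]) := by
  have h : ((Ideal.span {(p : ℤ_[p]) ^ M} : Ideal ℤ_[p]) : Set ℤ_[p]) =
      Metric.closedBall (0 : ℤ_[p]) ((p : ℝ) ^ (-(M : ℤ))) := by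
    ext x
    rw [SetLike.mem_coe, Metric.mem_closedBall, dist_zero_right, PadicInt.norm_le_pow_iff_mem_span_pow]
  rw [h]
  exact IsUltrametricDist.isOpen_closedBall _ (zpow_ne_zero _ (by exact_mod_cast hp.out.ne_zero))

/-- **`p^M ℤ_p^ι` is open in `ℤ_p^ι`** (`ι` finite; product of open sets). [folklore] -/
theorem isOpen_pi_span_pow {ι : Type*} [Finite ι] (M : ℕ) :
    IsOpen ((Submodule.pi Set.univ (fun _ : ι ↦ (Ideal.span {(p : ℤ_[p]) ^ M} : Ideal ℤ_[p])) :
      Submodule ℤ_[p] (ι → ℤ_[p])) : Set (ι → ℤ_[p])) := by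
  rw [Submodule.coe_pi]
  exact isOpen_set_pi Set.finite_univ fun _ _ ↦ isOpen_span_pow M

/-- **Cancellation of `p^j` in a `ℤ_p`-module without `p`-torsion**: `p^j • a = p^j • b → a = b`. [folklore] -/
theorem smul_cancel_of_torsionFree {H : Type*} [AddCommGroup H] [Module ℤ_[p] H]
    (htf : ∀ x : H, (p : ℤ_[p]) • x = 0 → x = 0) (j : ℕ) (a b : H)
    (h : ((p : ℤ_[p]) ^ j) • a = ((p : ℤ_[p]) ^ j) • b) : a = b := by
  induction j generalizing a b with
  | zero => simpa using h
  | succ j ih =>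
    rw [pow_succ', mul_smul, mul_smul] at h
    have h2 : (p : ℤ_[p]) • (((p : ℤ_[p]) ^ j) • a - ((p : ℤ_[p]) ^ j) • b) = 0 := by
      rw [smul_sub, h, sub_self]
    exact ih a b (sub_eq_zero.mp (htf _ h2))

/-- **A submodule of a torsion-free, `p`-adically separated `ℤ_p`-module whose reductions modulo `p^k` take at most `C · p^{Bk}`
values has rank `≤ B`.** `H`: a `ℤ_p`-module with `p • x = 0 → x = 0` and `(∀ k, x ∈ p^k H) → x = 0` (NOT assumed finitely
generated); `S ⊆ H` a submodule; for every `k` an additive `f k : S → G k` with values in a finite set `T k` of size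
`≤ C · p^{Bk}` and `f k x = 0 → x ∈ p^k H`. Then `Module.rank ℤ_[p] S ≤ B`. (Compactness of `ℤ_p^{B+1}` and Cantor's
intersection theorem replace finite generation; see the module docstring.) The shape is that of the compact Selmer layers
`𝔖(E/ℚ_n) ⊆ H¹(ℚ_n, T_pE)` reducing into the finite `Sel(ℚ_n, E[p^k]) ⊆ Sel_{p^∞}(E/ℚ_n)[p^k]`, `#(·) ≤ D · p^{(corank) k}`.
[cite: GreenbergLNM1716, §1 p. 60] [cite: Rubin2000, App. B Prop. B.2.3] [folklore] -/
theorem rank_le_of_card_image_le {H : Type*} [AddCommGroup H] [Module ℤ_[p] H]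
    (htf : ∀ x : H, (p : ℤ_[p]) • x = 0 → x = 0)
    (hsep : ∀ x : H, (∀ k : ℕ, ∃ y : H, ((p : ℤ_[p]) ^ k) • y = x) → x = 0)
    (S : Submodule ℤ_[p] H) {G : ℕ → Type*} [∀ k, AddCommGroup (G k)] (f : ∀ k : ℕ, S →+ G k)
    (T : ∀ k : ℕ, Set (G k)) (hT : ∀ k, (T k).Finite) (B C : ℕ) (hcard : ∀ k, Nat.card (T k) ≤ C * p ^ (B * k))
    (hf : ∀ (k : ℕ) (x : S), f k x ∈ T k)
    (hker : ∀ (k : ℕ) (x : S), f k x = 0 → ∃ y : H, ((p : ℤ_[p]) ^ k) • y = (x : H)) :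
    Module.rank ℤ_[p] S ≤ B := by
  have hpp : p.Prime := hp.out
  by_contra hrank
  -- an injective linear map `ℤ_p^{B+1} → S`
  have hle : ((B + 1 : ℕ) : Cardinal) ≤ Module.rank ℤ_[p] S := by
    rw [Nat.cast_add_one]
    exact Cardinal.natCast_add_one_le_iff.mpr (not_le.mp hrank)
  obtain ⟨φS, hφS⟩ := Module.le_rank_iff_exists_linearMap.mp hle
  let φ : (Fin (B + 1) → ℤ_[p]) →ₗ[ℤ_[p]] H := S.subtype ∘ₗ φS
  have hφ : Function.Injective φ := S.injective_subtype.comp hφS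
  have hφapply : ∀ v, φ v = (φS v : H) := fun _ ↦ rfl
  -- `E M = φ⁻¹(p^M H)`
  let E : ℕ → Submodule ℤ_[p] (Fin (B + 1) → ℤ_[p]) := fun M ↦
    { carrier := {v | ∃ y : H, ((p : ℤ_[p]) ^ M) • y = φ v}
      zero_mem' := ⟨0, by rw [smul_zero, map_zero]⟩
      add_mem' := by
        rintro a b ⟨y, hy⟩ ⟨z, hz⟩
        exact ⟨y + z, by rw [smul_add, hy, hz, map_add]⟩
      smul_mem' := by
        rintro c a ⟨y, hy⟩
        exact ⟨c • y, by rw [smul_comm, hy, map_smul]⟩ }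
  have hE : ∀ (M : ℕ) (v : Fin (B + 1) → ℤ_[p]), v ∈ E M ↔ ∃ y : H, ((p : ℤ_[p]) ^ M) • y = φ v :=
    fun _ _ ↦ Iff.rfl
  -- `O M = p^M ℤ_p^d`
  let O : ℕ → Submodule ℤ_[p] (Fin (B + 1) → ℤ_[p]) := fun M ↦
    Submodule.pi Set.univ fun _ ↦ (Ideal.span {(p : ℤ_[p]) ^ M} : Ideal ℤ_[p])
  have hO : ∀ (M : ℕ) (v : Fin (B + 1) → ℤ_[p]),
      v ∈ O M ↔ ∀ i, v i ∈ (Ideal.span {(p : ℤ_[p]) ^ M} : Ideal ℤ_[p]) := fun M v ↦ by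
    simp only [O, Submodule.mem_pi, Set.mem_univ, true_implies]
  have hO' : ∀ (M : ℕ) (v : Fin (B + 1) → ℤ_[p]),
      v ∈ O M ↔ ∃ w : Fin (B + 1) → ℤ_[p], ((p : ℤ_[p]) ^ M) • w = v := fun M v ↦ by
    rw [hO]
    constructor
    · intro h
      choose w hw using fun i ↦ Ideal.mem_span_singleton'.mp (h i)
      exact ⟨w, funext fun i ↦ by rw [Pi.smul_apply, smul_eq_mul, mul_comm, hw i]⟩
    · rintro ⟨w, rfl⟩ i
      rw [Pi.smul_apply, smul_eq_mul]
      exact Ideal.mem_span_singleton'.mpr ⟨w i, mul_comm _ _⟩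
  have hOE : ∀ M, O M ≤ E M := fun M v hv ↦ by
    obtain ⟨w, rfl⟩ := (hO' M v).mp hv
    exact ⟨φ w, by rw [map_smul]⟩
  have hEopen : ∀ M, IsOpen (E M : Set (Fin (B + 1) → ℤ_[p])) := fun M ↦
    Submodule.isOpen_mono (hOE M) (isOpen_pi_span_pow M)
  have hEclosed : ∀ M, IsClosed (E M : Set (Fin (B + 1) → ℤ_[p])) := fun M ↦
    (E M).toAddSubgroup.isClosed_of_isOpen (hEopen M)
  have hanti : ∀ M, (E (M + 1) : Set (Fin (B + 1) → ℤ_[p])) ⊆ E M := fun M v hv ↦ by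
    obtain ⟨y, hy⟩ := (hE (M + 1) v).mp hv
    exact (hE M v).mpr ⟨(p : ℤ_[p]) • y, by rw [smul_smul, ← pow_succ, hy]⟩
  have hEanti : Antitone (fun M ↦ (E M : Set (Fin (B + 1) → ℤ_[p]))) := antitone_nat_of_succ_le hanti
  -- `P` = the primitive vectors (not all coordinates divisible by `p`), a closed set
  let P : Set (Fin (B + 1) → ℤ_[p]) := ((O 1 : Submodule ℤ_[p] (Fin (B + 1) → ℤ_[p])) : Set (Fin (B + 1) → ℤ_[p]))ᶜ
  have hPclosed : IsClosed P := (isOpen_pi_span_pow (ι := Fin (B + 1)) 1).isClosed_compl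
  -- Cantor: some `P ∩ E M` is empty
  have hempty : ∃ M, P ∩ (E M : Set (Fin (B + 1) → ℤ_[p])) = ∅ := by
    by_contra hne
    have hne' : ∀ M, (P ∩ (E M : Set (Fin (B + 1) → ℤ_[p]))).Nonempty := fun M ↦
      Set.nonempty_iff_ne_empty.mpr fun h ↦ hne ⟨M, h⟩
    have hdir : Directed (· ⊇ ·) (fun M ↦ P ∩ (E M : Set (Fin (B + 1) → ℤ_[p]))) :=
      directed_of_isDirected_le fun i j hij ↦ Set.inter_subset_inter_right _ (hEanti hij)
    obtain ⟨v, hv⟩ := IsCompact.nonempty_iInter_of_directed_nonempty_isCompact_isClosed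
      (fun M ↦ P ∩ (E M : Set (Fin (B + 1) → ℤ_[p]))) hdir hne'
      (fun M ↦ (hPclosed.inter (hEclosed M)).isCompact) (fun M ↦ hPclosed.inter (hEclosed M))
    rw [Set.mem_iInter] at hv
    have hvP : v ∈ P := (hv 0).1
    have hv0 : φ v = 0 := hsep (φ v) fun k ↦ (hv k).2
    have hv00 : v = 0 := hφ (by rw [hv0, map_zero])
    exact hvP (by rw [SetLike.mem_coe, hv00]; exact (O 1).zero_mem)
  obtain ⟨M, hM⟩ := hempty
  have hprim : ∀ v, v ∈ E M → v ∈ O 1 := fun v hv ↦ by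
    by_contra h
    have hmem : v ∈ P ∩ (E M : Set (Fin (B + 1) → ℤ_[p])) := ⟨h, hv⟩
    rw [hM] at hmem
    exact hmem
  -- lifting divisibility: `φ v ∈ p^k H ⇒ v ∈ p^j ℤ_p^d` whenever `j + M ≤ k + 1`
  have hlift : ∀ (k j : ℕ), j + M ≤ k + 1 → ∀ v, v ∈ E k → v ∈ O j := by
    intro k j
    induction j with
    | zero =>
      intro _ v _
      exact (hO' 0 v).mpr ⟨v, by rw [pow_zero, one_smul]⟩
    | succ j ih =>
      intro hjM v hv
      have hj : j + M ≤ k + 1 := by omega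
      have hjk : j ≤ k := by omega
      obtain ⟨w, rfl⟩ := (hO' j _).mp (ih hj v hv)
      obtain ⟨y, hy⟩ := (hE k _).mp hv
      have hw : w ∈ E (k - j) := by
        refine (hE _ _).mpr ⟨y, smul_cancel_of_torsionFree htf j _ _ ?_⟩
        rw [smul_smul, ← pow_add, Nat.add_sub_cancel' hjk, hy, map_smul]
      have hwM : w ∈ E M := hEanti (show M ≤ k - j by omega) hw
      obtain ⟨w', rfl⟩ := (hO' 1 _).mp (hprim w hwM)
      refine (hO' (j + 1) _).mpr ⟨w', ?_⟩
      rw [pow_one, smul_smul, ← pow_succ]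
  -- counting at level `k = M + N`, `N = C · p^{BM}`, `m = N + 1`
  set N : ℕ := C * p ^ (B * M) with hN
  set k : ℕ := M + N with hk
  set m : ℕ := N + 1 with hm
  have hmk : m + M ≤ k + 1 := by omega
  haveI : Finite (T k) := (hT k).to_subtype
  let cast : (Fin (B + 1) → Fin (p ^ m)) → (Fin (B + 1) → ℤ_[p]) := fun a i ↦ ((a i : ℕ) : ℤ_[p])
  let Ψ : (Fin (B + 1) → Fin (p ^ m)) → T k := fun a ↦ ⟨f k (φS (cast a)), hf k _⟩
  have hΨ : Function.Injective Ψ := by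
    intro a b hab
    have h1 : f k (φS (cast a)) = f k (φS (cast b)) := congrArg Subtype.val hab
    have h2 : f k (φS (cast a - cast b)) = 0 := by rw [map_sub, map_sub, h1, sub_self]
    obtain ⟨y, hy⟩ := hker k _ h2
    have h3 : cast a - cast b ∈ E k := (hE k _).mpr ⟨y, by rw [hy, hφapply]⟩
    have h4 := (hO m _).mp (hlift k m hmk _ h3)
    funext i
    have h5 : ((a i : ℕ) : ℤ_[p]) - ((b i : ℕ) : ℤ_[p]) ∈ (Ideal.span {(p : ℤ_[p]) ^ m} : Ideal ℤ_[p]) := h4 i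
    rw [← PadicInt.ker_toZModPow, RingHom.mem_ker, map_sub, map_natCast, map_natCast, sub_eq_zero,
      ZMod.natCast_eq_natCast_iff', Nat.mod_eq_of_lt (a i).2, Nat.mod_eq_of_lt (b i).2] at h5
    exact Fin.ext h5
  have hcount : (p ^ m) ^ (B + 1) ≤ C * p ^ (B * k) := by
    calc (p ^ m) ^ (B + 1) = Nat.card (Fin (B + 1) → Fin (p ^ m)) := by
          rw [Nat.card_fun, Nat.card_fin, Nat.card_fin]
      _ ≤ Nat.card (T k) := Nat.card_le_card_of_injective Ψ hΨ
      _ ≤ C * p ^ (B * k) := hcard k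
  have h2 : p ^ (N + 1) * p ^ (B * N) ≤ N * p ^ (B * N) := by
    calc p ^ (N + 1) * p ^ (B * N) ≤ p ^ (N + 1) * p ^ (B * (N + 1)) :=
          Nat.mul_le_mul_left _ (Nat.pow_le_pow_right hpp.pos (Nat.mul_le_mul_left _ (Nat.le_succ N)))
      _ = (p ^ m) ^ (B + 1) := by
          rw [← pow_mul, ← pow_add, hm]
          congr 1
          ring
      _ ≤ C * p ^ (B * k) := hcount
      _ = N * p ^ (B * N) := by
          rw [hk, mul_add, pow_add, ← mul_assoc]
  have h3 : p ^ (N + 1) ≤ N := Nat.le_of_mul_le_mul_right h2 (Nat.pow_pos hpp.pos)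
  have h4 : N < p ^ (N + 1) :=
    (Nat.lt_pow_self hpp.one_lt).trans_le (Nat.pow_le_pow_right hpp.pos (Nat.le_succ N))
  exact absurd h3 (not_le.mpr h4)

end Summit.BirchSwinnertonDyer.BirchSwinnertonDyer.Theorems.ResidualThetaLayer.CompactRank

end
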